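import Summits.QuantumFields.YangMills.Theses.SqueezedSkewness
import HarnessLib

/-!
# Route `SqueezedSkewness` rev 7 — direction of strength of the «vacuum domination» re-decision

`theorem squeezedSkewness_pointlike_of_domination :
  HighBallFloors → DivisibleBump → VacuumDomination → PointlikeZeroTemperatureFloors`
(items stmt-QuantumFields-28191, 28193, 28192 ⟹ 27936, the every-radius cylinder-floor crux of rev 5–6, aside since
rev 7/8): for each radius `ρ`, `DivisibleBump` supplies a small positive-definite product bump `v ⊆ closedBall(e₀, ρ)` and a
high bump `f ⊆ closedBall(2e₀, 1/2)` whose lattice Laplace–Fourier sums are dominated, `c·|LF_s f| ≤ |LF_s v|` for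
`s ≤ s₀`; `HighBallFloors` floors `f` in the unit `(r, a)`; `VacuumDomination` transfers the eventual floor to `v` with
constant `c²/2` once `a(β) ≤ min s₀ 1` and `a(β)·L ≥ max 3 (1 + ρ)` (so both supports fit: `R ≤ a(β)·L`).
This is the `have hZ` block of the route's rev-7 `closes`, landed as a named theorem so that a proof of the three new
items closes 27936 by composition and a refutation of 27936 refutes their conjunction.

R3/RECORD framing: an implication between OPEN items (`--supports` 27936); no crux, NT (19353) or the Yang–Mills mass
gap is proved here.
-/

set_option autoImplicit false

namespace Summit.QuantumFields.YangMills.Theorems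

open Summit.QuantumFields.YangMills.Theses.SqueezedSkewness in
/-- rev 7 direction of strength: the three «vacuum domination» items imply `PointlikeZeroTemperatureFloors`. -/
theorem squeezedSkewness_pointlike_of_domination :
    HighBallFloors → DivisibleBump → VacuumDomination → PointlikeZeroTemperatureFloors := by
  intro hH hD hV G _ _ _ _ hG
  letI : MeasurableSpace G := borel G
  haveI : BorelSpace G := ⟨rfl⟩
  obtain ⟨r, a, ha, ha0, hfl⟩ := hH G hG
  refine ⟨r, a, ha, ha0, fun ρ hρ => ?_⟩
  obtain ⟨v, f, hv0, hvball, ⟨δ₁, δ₂, hδ₁, hvslab⟩, hf0, hfne, hfball, c, s₀, hc, hs₀, hdom⟩ := hD ρ hρ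
  obtain ⟨ε, β₅, Λ₅, hε, hfloor⟩ := hfl f hf0 hfne hfball
  obtain ⟨β₇, hβ₇⟩ : ∃ β₇ : ℝ, ∀ β, β₇ ≤ β → a β ≤ min s₀ 1 := by
    have h1 : ∀ᶠ β in Filter.atTop, a β < min s₀ 1 :=
      ha0.eventually (gt_mem_nhds (lt_min hs₀ one_pos))
    obtain ⟨β₇, hβ₇⟩ := Filter.eventually_atTop.mp h1
    exact ⟨β₇, fun β hβ => (hβ₇ β hβ).le⟩
  refine ⟨v, hv0, hvball, δ₁, δ₂, c ^ 2 * ε / 2, max β₅ (max β₇ 0), max Λ₅ (max 3 (1 + ρ)), hδ₁, hvslab,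
    by positivity, ?_⟩
  intro β hβ L hL
  simp only [max_le_iff] at hβ hL
  obtain ⟨hβ5, hβ7, hβ0⟩ := hβ
  obtain ⟨hL5, hL3, hLρ⟩ := hL
  have hfk := hfloor β hβ5 L hL5
  have has : a β ≤ s₀ := (hβ₇ β hβ7).trans (min_le_left _ _)
  have ha1 : a β ≤ 1 := (hβ₇ β hβ7).trans (min_le_right _ _)
  have hcoord : ∀ (y : EuclideanSpace ℝ (Fin 4)) (t ρ' : ℝ),
      y ∈ Metric.closedBall (EuclideanSpace.single (0 : Fin 4) t) ρ' → |y 0 - t| ≤ ρ' ∧ ‖y‖ ≤ ρ' + |t| := by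
    intro y t ρ' hy
    rw [Metric.mem_closedBall, dist_eq_norm] at hy
    refine ⟨?_, ?_⟩
    · have h0 := PiLp.norm_apply_le (y - EuclideanSpace.single (0 : Fin 4) t) 0
      have h0' : ‖(y - EuclideanSpace.single (0 : Fin 4) t) 0‖ = |y 0 - t| := by
        simp [Real.norm_eq_abs]
      rw [h0'] at h0
      exact h0.trans hy
    · have htri := norm_le_norm_add_norm_sub' y (EuclideanSpace.single (0 : Fin 4) t)
      have hs : ‖EuclideanSpace.single (0 : Fin 4) t‖ = |t| := by simp
      have hsub : ‖y - EuclideanSpace.single (0 : Fin 4) t‖ ≤ ρ' := hy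
      linarith
  have hf_pos : tsupport (f : EuclideanSpace ℝ (Fin 4) → ℝ) ⊆ {y : EuclideanSpace ℝ (Fin 4) | 0 < y 0} := by
    intro y hy
    have h := (hcoord y 2 (1 / 2) (hfball hy)).1
    show 0 < y 0
    rcases abs_le.mp h with ⟨h1, _⟩
    linarith
  have hf_R : tsupport (f : EuclideanSpace ℝ (Fin 4) → ℝ) ⊆
      Metric.closedBall (0 : EuclideanSpace ℝ (Fin 4)) (max 3 (1 + ρ)) := by
    intro y hy
    have h := (hcoord y 2 (1 / 2) (hfball hy)).2
    rw [Metric.mem_closedBall, dist_zero_right]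
    have : |(2 : ℝ)| = 2 := abs_of_pos two_pos
    exact le_trans (by linarith) (le_max_left _ _)
  have hv_pos : tsupport (v : EuclideanSpace ℝ (Fin 4) → ℝ) ⊆ {y : EuclideanSpace ℝ (Fin 4) | 0 < y 0} := by
    intro y hy
    have h := hvslab hy
    simp only [Set.mem_setOf_eq] at h ⊢
    linarith [h.1]
  have hv_R : tsupport (v : EuclideanSpace ℝ (Fin 4) → ℝ) ⊆
      Metric.closedBall (0 : EuclideanSpace ℝ (Fin 4)) (max 3 (1 + ρ)) := by
    intro y hy
    have h := (hcoord y 1 ρ (hvball hy)).2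
    rw [Metric.mem_closedBall, dist_zero_right]
    have : |(1 : ℝ)| = 1 := abs_of_pos one_pos
    exact le_trans (by linarith) (le_max_right _ _)
  have hRL : max 3 (1 + ρ) ≤ a β * L := max_le hL3 hLρ
  have hL1 : 1 ≤ L := by
    have hLnn : (0 : ℝ) ≤ (L : ℝ) := Nat.cast_nonneg L
    have hmul : a β * (L : ℝ) ≤ (L : ℝ) := mul_le_of_le_one_left hLnn ha1
    have h1 : (1 : ℝ) ≤ (L : ℝ) := by linarith
    exact_mod_cast h1
  have hlt : c ^ 2 * ε / 2 < c ^ 2 * ε := by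
    have : 0 < c ^ 2 * ε := by positivity
    linarith
  exact hV G r β L (a β) (max 3 (1 + ρ)) c v f hβ0 hL1 (ha β) hc.le hv_pos hv_R hf_pos hf_R hRL
    (fun E hE p => hdom (a β) (ha β) has E hE p) ε (c ^ 2 * ε / 2) hlt hfk

end Summit.QuantumFields.YangMills.Theorems
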